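import Literature.NumberTheory.Transcendental.KZCalculus
import Literature.NumberTheory.Transcendental.KZUnfolding
import Literature.NumberTheory.Transcendental.KZDilationMove
import Literature.NumberTheory.Transcendental.KZRelationsLE
import Literature.NumberTheory.Transcendental.KZSubcalculusInvariants
import Literature.NumberTheory.Transcendental.KZSemialgebraicComplex
import Literature.NumberTheory.Transcendental.KZIntervalPeriodProofs
import Literature.NumberTheory.Transcendental.KZRulesAssociator
import Literature.NumberTheory.Transcendental.KZLogCalculusProofs
import Literature.NumberTheory.Transcendental.KZSemiCanonicalReductionDimOne
import Mathlib.Analysis.SpecialFunctions.Integrals.Basic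
import Mathlib.Algebra.Order.Group.Pointwise.Interval
import HarnessLib

/-!
# The Kontsevich–Zagier conjecture in dimension `≤ 1`, I: standard cells and their moves

First file of an unconditional proof of the Kontsevich–Zagier period conjecture
(`Literature.Periods.KZPeriodConjecture`, i.e. `KZ.Equivalent r r'` for accessible-equal rational
representations) restricted to representations of dimension `≤ 1` (one-variable integrals of
rational functions over `ℚ`-semialgebraic subsets of `ℝ`).

Strategy of the whole proof.  (A) *Normal form by moves*: every rational one-variable
representation is congruent, modulo `KZ.relations`, to a `ℤ`-combination of three kinds of
STANDARD CELLS with real-algebraic parameters,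
* the constant cell `K(α) = [pt, α]` (dimension `0`),
* the logarithmic cell `L(c; a, b) = [[a, b], c/x]` (`0 < a`), value `c log (b/a)`,
* the arctangent cell `A(d; a, b) = [[a, b], d/(1 + x²)]`, value `d (arctan b − arctan a)`;
(B) *injectivity on cells*: every vanishing `ℤ`-combination of cell values is generated by
cell moves — Baker's theorem (`baker_decomposition_complex`, proved in the Literature library)
reduces this to INTEGER multiplicative relations among the `λ = b/a` and integer additive
relations among the angles, and those are realised by the two PEELING MOVES of this file:
`L(c; 1, μ) ≡ L(c; 1, λ) + L(c; 1, μ/λ)` (split at `λ`, dilate by `λ`) and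
`A(d; 0, ρ) ≡ A(d; 0, σ) + A(d; 0, (ρ−σ)/(1+σρ))` (split at `σ`, Möbius map
`u ↦ (u+σ)/(1−σu)`, which preserves `du/(1+u²)`).

This file: the line `ℝ¹`, one-variable representations `lineRep S f`, the cells, their values,
and the cell moves (domain splitting, integrand additivity, integer scaling, dilation,
reflection, the Möbius move, Newton–Leibniz to a constant cell) as members of `KZ.relations`.

References: M. Kontsevich, D. Zagier, *Periods* (2001), §1.1–1.2 (the three rules), §1.2
Problem 1; A. Baker, *Transcendental Number Theory* (1975), Thm 2.1 (used in part II via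
`Literature.NumberTheory.Transcendental.baker_decomposition_complex`).
-/

noncomputable section

open MeasureTheory Set Filter
open scoped BigOperators Topology

namespace Summit.KontsevichZagierPeriods.KontsevichZagierPeriods.Theorems

open Literature.NumberTheory.Transcendental
open Literature.NumberTheory.Transcendental.KZ
open Literature.ModelTheory.ExponentialFields (IsSemialgebraic isSemialgebraic_univ)

namespace SoloBlind

/-! ## The line `ℝ¹ = (Fin 1 → ℝ)` -/

/-- The subset of `ℝ¹` lying over `S ⊆ ℝ`. -/
def line (S : Set ℝ) : Set (Fin 1 → ℝ) := {x | x 0 ∈ S}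

/-- Membership in `line S`. -/
@[simp] theorem mem_line {S : Set ℝ} {x : Fin 1 → ℝ} : x ∈ line S ↔ x 0 ∈ S := Iff.rfl

/-- A constant tuple lies on `line S` iff its value lies in `S`. -/
@[simp] theorem const_mem_line {S : Set ℝ} {t : ℝ} : (fun _ : Fin 1 => t) ∈ line S ↔ t ∈ S :=
  Iff.rfl

/-- `line S` is the preimage of `S` under the canonical equivalence `ℝ¹ ≃ ℝ`. -/
theorem line_eq_preimage (S : Set ℝ) :
    line S = (MeasurableEquiv.funUnique (Fin 1) ℝ) ⁻¹' S := by
  ext x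
  simp [line, MeasurableEquiv.funUnique, Fin.default_eq_zero]

/-- `line` commutes with intersections. -/
theorem line_inter (S T : Set ℝ) : line (S ∩ T) = line S ∩ line T := rfl

/-- `line` commutes with unions. -/
theorem line_union (S T : Set ℝ) : line (S ∪ T) = line S ∪ line T := rfl

/-- `line` is monotone. -/
theorem line_mono {S T : Set ℝ} (h : S ⊆ T) : line S ⊆ line T := fun _ hx => h hx

/-- `line S` is measurable when `S` is. -/
theorem measurableSet_line {S : Set ℝ} (hS : MeasurableSet S) : MeasurableSet (line S) :=
  hS.preimage (measurable_pi_apply 0)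

/-- Lebesgue measure on `ℝ¹` over `S` is Lebesgue measure of `S`. -/
theorem volume_line (S : Set ℝ) : volume (line S) = volume S := by
  rw [line_eq_preimage]
  exact (volume_preserving_funUnique (Fin 1) ℝ).measure_preimage_emb
    (MeasurableEquiv.measurableEmbedding _) S

/-- Transfer of integrals from `ℝ¹` to `ℝ`. -/
theorem setIntegral_line (S : Set ℝ) (g : ℝ → ℝ) :
    ∫ x in line S, g (x 0) = ∫ t in S, g t := by
  rw [line_eq_preimage, ← (volume_preserving_funUnique (Fin 1) ℝ).setIntegral_preimage_emb
    (MeasurableEquiv.measurableEmbedding _) g S]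
  rfl

/-- Integrability transfers from `S` to `line S`. -/
theorem integrableOn_line {S : Set ℝ} {g : ℝ → ℝ} (hg : IntegrableOn g S) :
    IntegrableOn (fun x : Fin 1 → ℝ => g (x 0)) (line S) := by
  rw [line_eq_preimage]
  exact ((volume_preserving_funUnique (Fin 1) ℝ).integrableOn_comp_preimage
    (MeasurableEquiv.measurableEmbedding _)).mpr hg

/-! ### `ℚ`-semialgebraic intervals with real-algebraic end-points -/

/-- `line [a, ∞)` is `ℚ`-semialgebraic for `a` real algebraic. -/
theorem isSemialgebraic_line_Ici {a : ℝ} (ha : IsAlgebraic ℚ a) :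
    IsSemialgebraic ℚ (line (Ici a)) := by
  have hu := isSemialgebraic_univ (k := ℚ) (ι := Fin 1) (R := ℝ)
  have hf : IsSemialgebraicFunOn ℚ (univ : Set (Fin 1 → ℝ)) ((fun x => x 0) - fun _ => a) :=
    IsSemialgebraicFunOn.sub_holds (isSemialgebraicFunOn_apply hu 0)
      (isSemialgebraicFunOn_const_of_isAlgebraic hu ha)
  convert hf.isSemialgebraic_sep_nonneg using 1
  ext x
  simp [line, sub_nonneg]

/-- `line (−∞, b]` is `ℚ`-semialgebraic for `b` real algebraic. -/
theorem isSemialgebraic_line_Iic {b : ℝ} (hb : IsAlgebraic ℚ b) :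
    IsSemialgebraic ℚ (line (Iic b)) := by
  have hu := isSemialgebraic_univ (k := ℚ) (ι := Fin 1) (R := ℝ)
  have hf : IsSemialgebraicFunOn ℚ (univ : Set (Fin 1 → ℝ)) ((fun _ => b) - fun x => x 0) :=
    IsSemialgebraicFunOn.sub_holds (isSemialgebraicFunOn_const_of_isAlgebraic hu hb)
      (isSemialgebraicFunOn_apply hu 0)
  convert hf.isSemialgebraic_sep_nonneg using 1
  ext x
  simp [line, sub_nonneg]

/-- `line (a, ∞)` is `ℚ`-semialgebraic for `a` real algebraic. -/
theorem isSemialgebraic_line_Ioi {a : ℝ} (ha : IsAlgebraic ℚ a) :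
    IsSemialgebraic ℚ (line (Ioi a)) := by
  have hu := isSemialgebraic_univ (k := ℚ) (ι := Fin 1) (R := ℝ)
  have hf : IsSemialgebraicFunOn ℚ (univ : Set (Fin 1 → ℝ)) ((fun _ => a) - fun x => x 0) :=
    IsSemialgebraicFunOn.sub_holds (isSemialgebraicFunOn_const_of_isAlgebraic hu ha)
      (isSemialgebraicFunOn_apply hu 0)
  convert hf.isSemialgebraic_sep_neg using 1
  ext x
  simp [line, sub_neg]

/-- `line (−∞, b)` is `ℚ`-semialgebraic for `b` real algebraic. -/
theorem isSemialgebraic_line_Iio {b : ℝ} (hb : IsAlgebraic ℚ b) :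
    IsSemialgebraic ℚ (line (Iio b)) := by
  have hu := isSemialgebraic_univ (k := ℚ) (ι := Fin 1) (R := ℝ)
  have hf : IsSemialgebraicFunOn ℚ (univ : Set (Fin 1 → ℝ)) ((fun x => x 0) - fun _ => b) :=
    IsSemialgebraicFunOn.sub_holds (isSemialgebraicFunOn_apply hu 0)
      (isSemialgebraicFunOn_const_of_isAlgebraic hu hb)
  convert hf.isSemialgebraic_sep_neg using 1
  ext x
  simp [line, sub_neg]

/-- `line [a, b]` is `ℚ`-semialgebraic for `a, b` real algebraic. -/
theorem isSemialgebraic_line_Icc {a b : ℝ} (ha : IsAlgebraic ℚ a) (hb : IsAlgebraic ℚ b) :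
    IsSemialgebraic ℚ (line (Icc a b)) := by
  rw [← Ici_inter_Iic, line_inter]
  exact (isSemialgebraic_line_Ici ha).inter (isSemialgebraic_line_Iic hb)

/-- `line (a, b)` is `ℚ`-semialgebraic for `a, b` real algebraic. -/
theorem isSemialgebraic_line_Ioo {a b : ℝ} (ha : IsAlgebraic ℚ a) (hb : IsAlgebraic ℚ b) :
    IsSemialgebraic ℚ (line (Ioo a b)) := by
  rw [← Ioi_inter_Iio, line_inter]
  exact (isSemialgebraic_line_Ioi ha).inter (isSemialgebraic_line_Iio hb)

/-- `line (a, b]` is `ℚ`-semialgebraic for `a, b` real algebraic. -/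
theorem isSemialgebraic_line_Ioc {a b : ℝ} (ha : IsAlgebraic ℚ a) (hb : IsAlgebraic ℚ b) :
    IsSemialgebraic ℚ (line (Ioc a b)) := by
  rw [← Ioi_inter_Iic, line_inter]
  exact (isSemialgebraic_line_Ioi ha).inter (isSemialgebraic_line_Iic hb)

/-- `line [a, b)` is `ℚ`-semialgebraic for `a, b` real algebraic. -/
theorem isSemialgebraic_line_Ico {a b : ℝ} (ha : IsAlgebraic ℚ a) (hb : IsAlgebraic ℚ b) :
    IsSemialgebraic ℚ (line (Ico a b)) := by
  rw [← Ici_inter_Iio, line_inter]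
  exact (isSemialgebraic_line_Ici ha).inter (isSemialgebraic_line_Iio hb)

/-! ## One-variable representations -/

/-- `[S, f]`: the one-variable integral representation with domain (the line over) `S ⊆ ℝ` and
integrand `f`. -/
def lineRep (S : Set ℝ) (f : ℝ → ℝ) (hS : IsSemialgebraic ℚ (line S))
    (hf : IsSemialgebraicFunOn ℚ (line S) (fun x => f (x 0))) (hi : IntegrableOn f S) :
    IntegralRep 1 where
  domain := line S
  integrand x := f (x 0)
  isSemialgebraic_domain := hS
  isSemialgebraicFunOn_integrand := hf
  integrableOn := integrableOn_line hi

section lineRep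

variable {S : Set ℝ} {f : ℝ → ℝ} {hS : IsSemialgebraic ℚ (line S)}
  {hf : IsSemialgebraicFunOn ℚ (line S) (fun x => f (x 0))} {hi : IntegrableOn f S}

/-- The domain of `[S, f]` is `line S`. -/
@[simp] theorem lineRep_domain : (lineRep S f hS hf hi).domain = line S := rfl

/-- The integrand of `[S, f]` is `x ↦ f (x 0)`. -/
@[simp] theorem lineRep_integrand : (lineRep S f hS hf hi).integrand = fun x => f (x 0) := rfl

/-- The value of `[S, f]` is `∫_S f`. -/
theorem value_lineRep : (lineRep S f hS hf hi).value = ∫ t in S, f t :=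
  setIntegral_line S f

end lineRep

/-! ### Generic moves on representations -/

section generic

variable {n : ℕ}

/-- Integrand additivity with a pointwise hypothesis. -/
theorem of_sub_sub_mem_relations_of_add {r r₁ r₂ : IntegralRep n} (h₁ : r₁.domain = r.domain)
    (h₂ : r₂.domain = r.domain)
    (h : ∀ x ∈ r.domain, r.integrand x = r₁.integrand x + r₂.integrand x) :
    of r - of r₁ - of r₂ ∈ relations :=
  integrandAddRel_subset_relations ⟨n, r, r₁, r₂, h₁, h₂, fun x hx => by simp [h x hx], rfl⟩

/-- Opposite integrands cancel: `[σ, f] + [σ, −f]` is a relation. -/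
theorem of_add_of_mem_relations_of_neg {r r' : IntegralRep n} (hd : r'.domain = r.domain)
    (h : ∀ x ∈ r.domain, r'.integrand x = -r.integrand x) : of r + of r' ∈ relations := by
  set z : IntegralRep n := r.constMul 0 isAlgebraic_zero with hz
  have h1 : of z - of r - of r' ∈ relations :=
    integrandAddRel_subset_relations ⟨n, z, r, r', rfl, hd, fun x hx => by
      simp [hz, IntegralRep.constMul, h x hx], rfl⟩
  have h2 : of z ∈ relations :=
    levelRel_le_relations (of_mem_levelRel_of_eqOn_zero z fun x _ => by
      simp [hz, IntegralRep.constMul])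
  have := relations.sub_mem h2 h1
  convert this using 1
  abel

/-- Scaling the integrand by a natural number is multiplication in the formal group. -/
theorem of_sub_nsmul_mem_relations {r r' : IntegralRep n} (k : ℕ) (hd : r'.domain = r.domain)
    (h : ∀ x ∈ r.domain, r'.integrand x = k * r.integrand x) : of r' - k • of r ∈ relations := by
  have h1 : of r' - of (r.constMul (k : ℝ) (isAlgebraic_nat k)) ∈ relations :=
    of_sub_of_mem_relations_of_eqOn (by simp [IntegralRep.constMul, hd]) fun x hx => by
      simp [IntegralRep.constMul, h x (hd ▸ hx)]
  have h2 := r.of_constMul_nat_sub_nsmul_mem_relations k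
  have := relations.add_mem h1 h2
  convert this using 1
  abel

/-- Scaling the integrand by an integer is multiplication in the formal group. -/
theorem of_sub_zsmul_mem_relations {r r' : IntegralRep n} (k : ℤ) (hd : r'.domain = r.domain)
    (h : ∀ x ∈ r.domain, r'.integrand x = k * r.integrand x) : of r' - k • of r ∈ relations := by
  obtain ⟨m, rfl | rfl⟩ := Int.eq_nat_or_neg k
  · have := of_sub_nsmul_mem_relations (r := r) (r' := r') m hd (fun x hx => by
      simpa using h x hx)
    rw [natCast_zsmul]
    exact this
  · -- `r' = -(m • r)`: use the scaled representation `m • r` and negation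
    set rm : IntegralRep n := r.constMul (m : ℝ) (isAlgebraic_nat m) with hrm
    have h1 : of rm - m • of r ∈ relations := r.of_constMul_nat_sub_nsmul_mem_relations m
    have h2 : of rm + of r' ∈ relations :=
      of_add_of_mem_relations_of_neg (r := rm) (r' := r') (by simp [hrm, IntegralRep.constMul, hd])
        fun x hx => by
          have hx' : x ∈ r.domain := by simpa [hrm, IntegralRep.constMul] using hx
          simp [hrm, IntegralRep.constMul, h x hx']
    have := relations.sub_mem h2 h1
    convert this using 1
    rw [neg_smul, sub_neg_eq_add, natCast_zsmul]
    abel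

end generic

end SoloBlind

end Summit.KontsevichZagierPeriods.KontsevichZagierPeriods.Theorems
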